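import Literature.AlgebraicGeometry.Motives.HilbertImageInGrassmannianRepresents
import Literature.AlgebraicGeometry.Motives.GrassmannianQuotientIsoPullback
import Literature.AlgebraicGeometry.Motives.GrassmannianSchemeProper
import Literature.AlgebraicGeometry.Modules.VanishingLocusFiniteLocallyFree
import Literature.AlgebraicGeometry.Modules.ProjectiveFamilyTwistPushforward
import Literature.AlgebraicGeometry.Motives.FlatFamilyCutOutByDegreeEquations
import Literature.AlgebraicGeometry.Motives.FlatFamilyHilbertPolynomialGrassmannianPoint
import Literature.AlgebraicGeometry.Modules.FlatteningStratumUniversalFamilyFlat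
import Literature.AlgebraicGeometry.Modules.ProjectiveFamilyTwistPushforwardPointRank
import Literature.AlgebraicGeometry.Motives.GrassmannianRepresentable
import Mathlib.AlgebraicGeometry.IdealSheaf.Functorial
import Mathlib.AlgebraicGeometry.Morphisms.Immersion
import HarnessLib

/-!
# `Hilb ↪ Grass`, the heads: the Hilbert scheme of `𝐏(ι)` as the flattening stratum of the universal family over the
# Grassmannian (Mumford, *Curves on an algebraic surface*, Lect. 15 (III.)–(V.); MFK Ch. 0 §5 (c))

Topic `AlgebraicGeometry/Motives`; THEOREMS ONLY.  F-5 (5d) (III-Gr) of cell `hodgecm-mathlib`, sequel of ★ `HilbertImageInGrassmannianRepresents`.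
With `Gr = Grass_{P(d)}(ℤ^{(Mon_d)})` and `Z_𝒦 = V((kι_𝒦 ≫ φ_Gr)♭) ⊂ 𝐏(ι; Gr)` the vanishing locus of the universal equations, «`Hilb^P` is the
subscheme `H ⊂ Gr` over which `Z_𝒦` is flat with Hilbert polynomial `P`» (Lect. 15 (IV.), Lect. 8), because a flat `Z ⊂ 𝐏(ι; T)` with
polynomial `P` is `Z_𝒦 ×_{Gr} T` along its point `g` ((II.)+(IV.)) and the point of `Z_𝒦` over the stratum is the identity ((III.)).
§1–§2 bricks; §3 heads (H1)∕(H2) over the opaque letters `hHB2K` (★ ⑩b), `hcut` (★ (II′)), `hγ` (★ ③b); §4 at `Z_𝒦 := V(…).subscheme`;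
§5 `hcut`∕`hγ` discharged; §6 the CLOSED heads `exists_grassmannianImmersion_universal_flat_family` (with `j : H ↪ Gr`), `exists_universal_flat_family`.
References: [Mumford1966CurvesSurface, Lecture 15 (II.)–(V.) (pp. 106–108), Lecture 8 3° (pp. 58–59)]; [MumfordFogartyKirwan1994, Ch. 0 §5 (c)
(p. 23)]; [GortzWedhorn2020, (8.4), Prop. 4.20]; [Hartshorne1977, II Prop. 5.13, II Ex. 3.11 (a)]; [StacksProject, Tag 01NF].  Count-neutral
capital; HC_CM is proved only modulo the 7 printed citations until rung 0 closes.
-/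

noncomputable section
-- `TopCat.Presheaf`/`Scheme.Modules` are not reducible (as in Mathlib's `AlgebraicGeometry/Modules/Tilde.lean`).
set_option backward.isDefEq.respectTransparency false

open CategoryTheory Opposite TensorProduct TopologicalSpace AlgebraicGeometry Limits
open Literature.AlgebraicGeometry.Motives

universe u

namespace Literature.AlgebraicGeometry.Motives

open Literature.AlgebraicGeometry.Modules Literature.AlgebraicGeometry.Motives.Grassmannian

/-! ## §1 A closed subscheme with the ideal of a base change IS the base change -/

section ClosedImmersionBricks

/-- **The ideal of a base-changed closed immersion is the pulled-back ideal**: for a cartesian square `ZX = ZY ×_Y X` with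
`iY : ZY ⟶ Y` a closed immersion, `𝓘(iX) = f⁻¹𝓘(iY)·𝒪_X` (Mathlib `ker_fst_of_isClosedImmersion`, transported along the
comparison isomorphism with the chosen pull-back). [cite: GortzWedhorn2020, Prop. 4.20 (p. 104)] -/
theorem ker_eq_comap_of_isPullback_of_isClosedImmersion {X Y ZX ZY : Scheme.{u}} {e : ZX ⟶ ZY} {iX : ZX ⟶ X}
    {iY : ZY ⟶ Y} {f : X ⟶ Y} [IsClosedImmersion iY] (H : IsPullback e iX iY f) : iX.ker = iY.ker.comap f := by
  rw [← Scheme.IdealSheafData.ker_fst_of_isClosedImmersion iY f, ← H.flip.isoPullback_hom_fst,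
    Scheme.Hom.ker_comp_of_isIso]

/-- **A closed subscheme whose ideal is the pulled-back ideal IS the base change**: if `iX : ZX ⟶ X` and `iY : ZY ⟶ Y` are
closed immersions with `𝓘(iX) = f⁻¹𝓘(iY)·𝒪_X`, then `ZX ⟶ X` is the pull-back of `ZY ⟶ Y` along `f`, the comparison map being
the lift of `iX ≫ f` through `iY` (Mathlib `IsClosedImmersion.lift`, `isPullback_of_isClosedImmersion`).
[cite: GortzWedhorn2020, Prop. 4.20 (p. 104)] [cite: Hartshorne1977, II Ex. 3.11 (a) (p. 92)] -/
theorem exists_isPullback_of_ker_eq_comap {X Y ZX ZY : Scheme.{u}} (iX : ZX ⟶ X) (iY : ZY ⟶ Y) (f : X ⟶ Y)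
    [IsClosedImmersion iX] [IsClosedImmersion iY] (h : iX.ker = iY.ker.comap f) :
    ∃ e : ZX ⟶ ZY, IsPullback e iX iY f := by
  have hle : iY.ker ≤ (iX ≫ f).ker := by
    rw [← Scheme.IdealSheafData.map_ker, h]
    exact Scheme.IdealSheafData.le_map_comap _ _
  exact ⟨IsClosedImmersion.lift iY (iX ≫ f) hle, (isPullback_of_isClosedImmersion iX iY
    (IsClosedImmersion.lift iY (iX ≫ f) hle) f (by rw [IsClosedImmersion.lift_fac]) h.symm).flip⟩

/-- `𝐏(ι; -)` is functorial: `𝐏(h ≫ g) = 𝐏(h) ≫ 𝐏(g)` (any index type `ι`). [cite: StacksProject, Tag 01NF] -/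
private theorem projectiveSpaceMap_comp' (ι : Type u) {S T T' : Scheme.{u}} (h : T' ⟶ T) (g : T ⟶ S) :
    Morphisms.projectiveSpaceMap ι (h ≫ g) = Morphisms.projectiveSpaceMap ι h ≫ Morphisms.projectiveSpaceMap ι g := by
  apply pullback.hom_ext
  · rw [Category.assoc, Morphisms.projectiveSpaceMap_fst, Morphisms.projectiveSpaceMap_fst,
      Morphisms.projectiveSpaceMap_fst_assoc]
  · rw [Category.assoc, Morphisms.projectiveSpaceMap_snd, Morphisms.projectiveSpaceMap_snd, Morphisms.projectiveSpaceMap_snd]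

end ClosedImmersionBricks

/-! ## §2 The monomial map of `𝐏(ι; T)`, the equations of a point of `Gr`, and the two halves of Lect. 15 (V.) -/

section MonomialMap

variable {ι : Type} (T : Scheme.{0}) (d : ℕ)

/-- **The monomial map `φ_T : 𝒪_T^{(Mon_d)} ⟶ (π_T)_* 𝒪_{𝐏(ι; T)}(d)`, `ε_w ↦ μ_w`, exists** (★ `exists_hom_freeModule_app_eq` at the
global monomial sections ★ `SerreTwist.monomialSection`) — recorded in BOTH letters of record (★ (L-iv)/(EqBC)'s, with the restriction
written in `𝒪_𝐏(d)`, and (II′)'s, written in `(π_T)_* 𝒪_𝐏(d)`; they agree definitionally). [cite: Hartshorne1977, II Prop. 5.13 (p. 117)] -/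
theorem exists_monomialMap_projectiveSpace :
    ∃ φT : freeModule T (Fin d → Fin (Nat.card ι + 1)) ⟶
        (Scheme.Modules.pushforward (Morphisms.projectiveSpaceFst ι T)).obj
          (SerreTwist.twistMod (pullback.snd (terminal.from T) (terminal.from (Morphisms.projectiveSpaceInt ι)))
            (unitModule (Morphisms.projectiveSpace ι T)) d),
      (∀ (w : Fin d → Fin (Nat.card ι + 1)) (V : T.Opens), φT.app V (freeSectionOn T w V) =
        (SerreTwist.twistMod (pullback.snd (terminal.from T) (terminal.from (Morphisms.projectiveSpaceInt ι)))
            (unitModule (Morphisms.projectiveSpace ι T)) d).presheaf.map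
          (homOfLE (le_top : (Morphisms.projectiveSpaceFst ι T) ⁻¹ᵁ V ≤ ⊤)).op
          (SerreTwist.monomialSection (pullback.snd (terminal.from T) (terminal.from (Morphisms.projectiveSpaceInt ι))) d w)) ∧
      ∀ (w : Fin d → Fin (Nat.card ι + 1)) (V : T.Opens), φT.app V (freeSectionOn T w V) =
        ((Scheme.Modules.pushforward (Morphisms.projectiveSpaceFst ι T)).obj
          (SerreTwist.twistMod (pullback.snd (terminal.from T) (terminal.from (Morphisms.projectiveSpaceInt ι)))
            (unitModule (Morphisms.projectiveSpace ι T)) d)).presheaf.map (homOfLE (le_top : V ≤ ⊤)).op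
          (show Γ((Scheme.Modules.pushforward (Morphisms.projectiveSpaceFst ι T)).obj
            (SerreTwist.twistMod (pullback.snd (terminal.from T) (terminal.from (Morphisms.projectiveSpaceInt ι)))
              (unitModule (Morphisms.projectiveSpace ι T)) d), ⊤) from
            SerreTwist.monomialSection (pullback.snd (terminal.from T) (terminal.from (Morphisms.projectiveSpaceInt ι))) d w) := by
  obtain ⟨φT, hφT⟩ := exists_hom_freeModule_app_eq
    ((Scheme.Modules.pushforward (Morphisms.projectiveSpaceFst ι T)).obj
      (SerreTwist.twistMod (pullback.snd (terminal.from T) (terminal.from (Morphisms.projectiveSpaceInt ι)))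
        (unitModule (Morphisms.projectiveSpace ι T)) d))
    (fun w => show Γ((Scheme.Modules.pushforward (Morphisms.projectiveSpaceFst ι T)).obj
      (SerreTwist.twistMod (pullback.snd (terminal.from T) (terminal.from (Morphisms.projectiveSpaceInt ι)))
        (unitModule (Morphisms.projectiveSpace ι T)) d), ⊤) from
      SerreTwist.monomialSection (pullback.snd (terminal.from T) (terminal.from (Morphisms.projectiveSpaceInt ι))) d w)
  exact ⟨φT, fun w V => hφT w V, hφT⟩

end MonomialMap

section Hilb

variable {ι : Type} (d k : ℕ)
  [(grassmannianSheaf ((Fin d → Fin (Nat.card ι + 1)) →₀ ℤ) k).obj.IsRepresentable]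
  -- the monomial map `φGr : 𝒪^{(Mon_d)} ⟶ π_* 𝒪_𝐏(d)` of `𝐏(ι; Gr)`, `ε_w ↦ μ_w` (★ (EqBC) letter)
  (φGr : freeModule (grassmannianScheme ((Fin d → Fin (Nat.card ι + 1)) →₀ ℤ) k) (Fin d → Fin (Nat.card ι + 1)) ⟶
    (Scheme.Modules.pushforward (Morphisms.projectiveSpaceFst ι
      (grassmannianScheme ((Fin d → Fin (Nat.card ι + 1)) →₀ ℤ) k))).obj
      (SerreTwist.twistMod (pullback.snd (terminal.from (grassmannianScheme ((Fin d → Fin (Nat.card ι + 1)) →₀ ℤ) k))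
        (terminal.from (Morphisms.projectiveSpaceInt ι)))
        (unitModule (Morphisms.projectiveSpace ι (grassmannianScheme ((Fin d → Fin (Nat.card ι + 1)) →₀ ℤ) k))) d))
  (hφGr : ∀ (w : Fin d → Fin (Nat.card ι + 1)) (V : (grassmannianScheme ((Fin d → Fin (Nat.card ι + 1)) →₀ ℤ) k).Opens),
    φGr.app V (freeSectionOn _ w V) =
    (SerreTwist.twistMod (pullback.snd (terminal.from (grassmannianScheme ((Fin d → Fin (Nat.card ι + 1)) →₀ ℤ) k))
        (terminal.from (Morphisms.projectiveSpaceInt ι)))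
        (unitModule (Morphisms.projectiveSpace ι (grassmannianScheme ((Fin d → Fin (Nat.card ι + 1)) →₀ ℤ) k))) d).presheaf.map
      (homOfLE (le_top : (Morphisms.projectiveSpaceFst ι (grassmannianScheme ((Fin d → Fin (Nat.card ι + 1)) →₀ ℤ) k)) ⁻¹ᵁ V ≤
        ⊤)).op
      (SerreTwist.monomialSection (pullback.snd (terminal.from (grassmannianScheme ((Fin d → Fin (Nat.card ι + 1)) →₀ ℤ) k))
        (terminal.from (Morphisms.projectiveSpaceInt ι))) d w))
  -- the universal family: ANY closed subscheme of `𝐏(ι; Gr)` whose ideal is that of the universal equations `(kι_𝒦 ≫ φGr)♭`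
  {ZK : Scheme.{0}} (iK : ZK ⟶ Morphisms.projectiveSpace ι (grassmannianScheme ((Fin d → Fin (Nat.card ι + 1)) →₀ ℤ) k))
  [IsClosedImmersion iK]
  (hiK : iK.ker = vanishingIdeal (((Scheme.Modules.pullbackPushforwardAdjunction
    (Morphisms.projectiveSpaceFst ι (grassmannianScheme ((Fin d → Fin (Nat.card ι + 1)) →₀ ℤ) k))).homEquiv _ _).symm
    (kernel.ι (universalQuotientπ k ((Fin d → Fin (Nat.card ι + 1)) →₀ ℤ) Finsupp.basisSingleOne) ≫ φGr)))
  -- the Hilbert polynomial enters only through its values `R e`, `e ≥ e₀`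
  (e₀ : ℕ) (R : ℕ → ℕ)
  -- (H-B2) THE FLATTENING STRATUM OF THE UNIVERSAL FAMILY (★ slot ⑩/⑩b conclusion at `S := Gr`, opaque here)
  (hHB2 : ∃ (H : Scheme.{0}) (j : H ⟶ grassmannianScheme ((Fin d → Fin (Nat.card ι + 1)) →₀ ℤ) k), IsImmersion j ∧
    ∀ ⦃T : Scheme.{0}⦄ [IsLocallyNoetherian T] (g : T ⟶ grassmannianScheme ((Fin d → Fin (Nat.card ι + 1)) →₀ ℤ) k)
      ⦃ZT : Scheme.{0}⦄ (iT : ZT ⟶ Morphisms.projectiveSpace ι T) [IsClosedImmersion iT] (kT : ZT ⟶ ZK)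
      (_ : IsPullback kT iT iK (Morphisms.projectiveSpaceMap ι g)),
      (∃! v : T ⟶ H, v ≫ j = g) ↔
        (Flat (iT ≫ Morphisms.projectiveSpaceFst ι T) ∧ ∀ e, e₀ ≤ e → HasRank
          ((Scheme.Modules.pushforward (iT ≫ Morphisms.projectiveSpaceFst ι T)).obj
            (SerreTwist.twistMod (iT ≫ pullback.snd (terminal.from T) (terminal.from (Morphisms.projectiveSpaceInt ι)))
              (unitModule ZT) e)) (R e)))
  -- (II′) A FLAT FAMILY WITH THE RANKS IS CUT OUT BY ITS DEGREE-`d` EQUATIONS (slot ⑥ letter, opaque here)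
  (hcut : ∀ ⦃T Z : Scheme.{0}⦄ [IsLocallyNoetherian T] (i : Z ⟶ Morphisms.projectiveSpace ι T) [IsClosedImmersion i]
    [Flat (i ≫ Morphisms.projectiveSpaceFst ι T)],
    (∀ e, e₀ ≤ e → HasRank ((Scheme.Modules.pushforward (i ≫ Morphisms.projectiveSpaceFst ι T)).obj
      (SerreTwist.twistMod (i ≫ pullback.snd (terminal.from T) (terminal.from (Morphisms.projectiveSpaceInt ι)))
        (unitModule Z) e)) (R e)) →
    ∀ (ψ : freeModule T (Fin d → Fin (Nat.card ι + 1)) ⟶ (Scheme.Modules.pushforward (i ≫ Morphisms.projectiveSpaceFst ι T)).obj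
      (SerreTwist.twistMod (i ≫ pullback.snd (terminal.from T) (terminal.from (Morphisms.projectiveSpaceInt ι))) (unitModule Z) d)),
    (∀ (w : Fin d → Fin (Nat.card ι + 1)) (V : T.Opens), ψ.app V (freeSectionOn T w V) =
      ((Scheme.Modules.pushforward (i ≫ Morphisms.projectiveSpaceFst ι T)).obj
        (SerreTwist.twistMod (i ≫ pullback.snd (terminal.from T) (terminal.from (Morphisms.projectiveSpaceInt ι)))
          (unitModule Z) d)).presheaf.map (homOfLE (le_top : V ≤ ⊤)).op
        (show Γ((Scheme.Modules.pushforward (i ≫ Morphisms.projectiveSpaceFst ι T)).obj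
          (SerreTwist.twistMod (i ≫ pullback.snd (terminal.from T) (terminal.from (Morphisms.projectiveSpaceInt ι)))
            (unitModule Z) d), ⊤) from
          SerreTwist.monomialSection (i ≫ pullback.snd (terminal.from T) (terminal.from (Morphisms.projectiveSpaceInt ι))) d w)) →
    ∀ (φ : freeModule T (Fin d → Fin (Nat.card ι + 1)) ⟶ (Scheme.Modules.pushforward (Morphisms.projectiveSpaceFst ι T)).obj
      (SerreTwist.twistMod (pullback.snd (terminal.from T) (terminal.from (Morphisms.projectiveSpaceInt ι)))
        (unitModule (Morphisms.projectiveSpace ι T)) d)),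
    (∀ (w : Fin d → Fin (Nat.card ι + 1)) (V : T.Opens), φ.app V (freeSectionOn T w V) =
      ((Scheme.Modules.pushforward (Morphisms.projectiveSpaceFst ι T)).obj
        (SerreTwist.twistMod (pullback.snd (terminal.from T) (terminal.from (Morphisms.projectiveSpaceInt ι)))
          (unitModule (Morphisms.projectiveSpace ι T)) d)).presheaf.map (homOfLE (le_top : V ≤ ⊤)).op
        (show Γ((Scheme.Modules.pushforward (Morphisms.projectiveSpaceFst ι T)).obj
          (SerreTwist.twistMod (pullback.snd (terminal.from T) (terminal.from (Morphisms.projectiveSpaceInt ι)))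
            (unitModule (Morphisms.projectiveSpace ι T)) d), ⊤) from
          SerreTwist.monomialSection (pullback.snd (terminal.from T) (terminal.from (Morphisms.projectiveSpaceInt ι))) d w)) →
    i.ker = vanishingIdeal (((Scheme.Modules.pullbackPushforwardAdjunction (Morphisms.projectiveSpaceFst ι T)).homEquiv _ _).symm
      (kernel.ι ψ ≫ φ)))
  -- γ A FLAT FAMILY WITH THE RANKS HAS A `Gr`-POINT THROUGH THE MONOMIAL SECTIONS OF `𝒪_Z(d)` (★ slot ③b conclusion, opaque here)
  (hγ : ∀ ⦃T Z : Scheme.{0}⦄ [IsLocallyNoetherian T] (i : Z ⟶ Morphisms.projectiveSpace ι T) [IsClosedImmersion i]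
    [Flat (i ≫ Morphisms.projectiveSpaceFst ι T)],
    (∀ e, e₀ ≤ e → HasRank ((Scheme.Modules.pushforward (i ≫ Morphisms.projectiveSpaceFst ι T)).obj
      (SerreTwist.twistMod (i ≫ pullback.snd (terminal.from T) (terminal.from (Morphisms.projectiveSpaceInt ι)))
        (unitModule Z) e)) (R e)) →
    ∃ g : T ⟶ grassmannianScheme ((Fin d → Fin (Nat.card ι + 1)) →₀ ℤ) k, ∀ V : T.affineOpens,
      (evalAffine V.2 (pointsEquiv ((Fin d → Fin (Nat.card ι + 1)) →₀ ℤ) k T g)).toSubmodule =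
        LinearMap.ker (sectionsMap (Finsupp.basisSingleOne : Module.Basis (Fin d → Fin (Nat.card ι + 1)) ℤ _)
          ((Scheme.Modules.pushforward (i ≫ Morphisms.projectiveSpaceFst ι T)).obj
            (SerreTwist.twistMod (i ≫ pullback.snd (terminal.from T) (terminal.from (Morphisms.projectiveSpaceInt ι)))
              (unitModule Z) d))
          (fun w => SerreTwist.monomialSection
            (i ≫ pullback.snd (terminal.from T) (terminal.from (Morphisms.projectiveSpaceInt ι))) d w) V))
  -- a base, a point, the monomial map of `𝐏(ι; T)` in its two letters (★ (L-iv)/(EqBC)'s and (II′)'s)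
  {T : Scheme.{0}} (g : T ⟶ grassmannianScheme ((Fin d → Fin (Nat.card ι + 1)) →₀ ℤ) k)
  (φT : freeModule T (Fin d → Fin (Nat.card ι + 1)) ⟶
    (Scheme.Modules.pushforward (Morphisms.projectiveSpaceFst ι T)).obj
      (SerreTwist.twistMod (pullback.snd (terminal.from T) (terminal.from (Morphisms.projectiveSpaceInt ι)))
        (unitModule (Morphisms.projectiveSpace ι T)) d))
  (hφT : ∀ (w : Fin d → Fin (Nat.card ι + 1)) (V : T.Opens), φT.app V (freeSectionOn T w V) =
    (SerreTwist.twistMod (pullback.snd (terminal.from T) (terminal.from (Morphisms.projectiveSpaceInt ι)))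
        (unitModule (Morphisms.projectiveSpace ι T)) d).presheaf.map
      (homOfLE (le_top : (Morphisms.projectiveSpaceFst ι T) ⁻¹ᵁ V ≤ ⊤)).op
      (SerreTwist.monomialSection (pullback.snd (terminal.from T) (terminal.from (Morphisms.projectiveSpaceInt ι))) d w))
  (hφT' : ∀ (w : Fin d → Fin (Nat.card ι + 1)) (V : T.Opens), φT.app V (freeSectionOn T w V) =
    ((Scheme.Modules.pushforward (Morphisms.projectiveSpaceFst ι T)).obj
      (SerreTwist.twistMod (pullback.snd (terminal.from T) (terminal.from (Morphisms.projectiveSpaceInt ι)))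
        (unitModule (Morphisms.projectiveSpace ι T)) d)).presheaf.map (homOfLE (le_top : V ≤ ⊤)).op
      (show Γ((Scheme.Modules.pushforward (Morphisms.projectiveSpaceFst ι T)).obj
        (SerreTwist.twistMod (pullback.snd (terminal.from T) (terminal.from (Morphisms.projectiveSpaceInt ι)))
          (unitModule (Morphisms.projectiveSpace ι T)) d), ⊤) from
        SerreTwist.monomialSection (pullback.snd (terminal.from T) (terminal.from (Morphisms.projectiveSpaceInt ι))) d w))
  -- a closed subscheme `Z ⊂ 𝐏(ι; T)` classified by `g` through the monomial sections of `𝒪_Z(d)` (★ γ letter)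
  {Z : Scheme.{0}} (i : Z ⟶ Morphisms.projectiveSpace ι T) [IsClosedImmersion i]
  (hcl : ∀ V : T.affineOpens,
    (evalAffine V.2 (pointsEquiv ((Fin d → Fin (Nat.card ι + 1)) →₀ ℤ) k T g)).toSubmodule =
      LinearMap.ker (sectionsMap (Finsupp.basisSingleOne : Module.Basis (Fin d → Fin (Nat.card ι + 1)) ℤ _)
        ((Scheme.Modules.pushforward (i ≫ Morphisms.projectiveSpaceFst ι T)).obj
          (SerreTwist.twistMod (i ≫ pullback.snd (terminal.from T) (terminal.from (Morphisms.projectiveSpaceInt ι)))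
            (unitModule Z) d))
        (fun w => SerreTwist.monomialSection
          (i ≫ pullback.snd (terminal.from T) (terminal.from (Morphisms.projectiveSpaceInt ι))) d w) V))

omit [IsClosedImmersion iK] in
include hφGr hiK hφT in
/-- **The pulled-back ideal of the universal family is the ideal of the equations of the point**: for `g : T ⟶ Gr` there is a
presentation `ψ_g : 𝒪_T^{(Mon_d)} ↠ g^*𝒬` (`ε_w ↦ η(q_w)`, ★ `exists_epi_freeModule_pullback_universalQuotient`) with affine-localizing
kernel and `(pointsEquiv g)|_V = ker θ_V(g^*𝒬, ψ_g ε)` (★ `ker_sectionsMap_pullback_universalQuotient`), and for it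
`𝐏(g)⁻¹ 𝓘(Z_K) = V((kι_{ψ_g} ≫ φ_T)♭)` (★ (EqBC) `comap_vanishingIdeal_universalEquations_eq`).
[cite: Mumford1966CurvesSurface, Lecture 15 (IV.) (p. 107)] [cite: GortzWedhorn2020, (8.4) (pp. 213–215)] -/
theorem exists_presentation_comap_ker_eq :
    ∃ (ψ : freeModule T (Fin d → Fin (Nat.card ι + 1)) ⟶ (Scheme.Modules.pullback g).obj
        (universalQuotient k ((Fin d → Fin (Nat.card ι + 1)) →₀ ℤ) Finsupp.basisSingleOne))
      (_ : ∀ (w : Fin d → Fin (Nat.card ι + 1)) (V : T.Opens), ψ.app V (freeSectionOn T w V) =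
        ((Scheme.Modules.pullback g).obj (universalQuotient k _ Finsupp.basisSingleOne)).presheaf.map (homOfLE (le_top : V ≤ ⊤)).op
          (unitSection g (universalQuotient k _ Finsupp.basisSingleOne) ⊤
            (universalQuotientSection k ((Fin d → Fin (Nat.card ι + 1)) →₀ ℤ) Finsupp.basisSingleOne w)))
      (_ : Epi ψ) (_ : IsAffineLocalizing (kernel ψ))
      (_ : ∀ V : T.affineOpens,
        (evalAffine V.2 (pointsEquiv ((Fin d → Fin (Nat.card ι + 1)) →₀ ℤ) k T g)).toSubmodule =
          LinearMap.ker (sectionsMap (Finsupp.basisSingleOne : Module.Basis (Fin d → Fin (Nat.card ι + 1)) ℤ _)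
            ((Scheme.Modules.pullback g).obj (universalQuotient k _ Finsupp.basisSingleOne))
            (fun w => ψ.app ⊤ (freeSectionOn T w ⊤)) V)),
      iK.ker.comap (Morphisms.projectiveSpaceMap ι g) =
        vanishingIdeal (((Scheme.Modules.pullbackPushforwardAdjunction (Morphisms.projectiveSpaceFst ι T)).homEquiv _ _).symm
          (kernel.ι ψ ≫ φT)) := by
  classical
  obtain ⟨ψ, hψ, hepi⟩ := exists_epi_freeModule_pullback_universalQuotient k ((Fin d → Fin (Nat.card ι + 1)) →₀ ℤ)
    Finsupp.basisSingleOne g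
  have hψtop : (fun w => ψ.app ⊤ (freeSectionOn T w ⊤)) = fun w =>
      unitSection g (universalQuotient k _ Finsupp.basisSingleOne) ⊤
        (universalQuotientSection k ((Fin d → Fin (Nat.card ι + 1)) →₀ ℤ) Finsupp.basisSingleOne w) := by
    funext w
    rw [hψ w ⊤, show homOfLE (le_top : (⊤ : T.Opens) ≤ ⊤) = 𝟙 _ from Subsingleton.elim _ _, op_id,
      ((Scheme.Modules.pullback g).obj (universalQuotient k _ Finsupp.basisSingleOne)).presheaf.map_id]
    rfl
  have hcl : ∀ V : T.affineOpens,
      (evalAffine V.2 (pointsEquiv ((Fin d → Fin (Nat.card ι + 1)) →₀ ℤ) k T g)).toSubmodule =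
        LinearMap.ker (sectionsMap (Finsupp.basisSingleOne : Module.Basis (Fin d → Fin (Nat.card ι + 1)) ℤ _)
          ((Scheme.Modules.pullback g).obj (universalQuotient k _ Finsupp.basisSingleOne))
          (fun w => ψ.app ⊤ (freeSectionOn T w ⊤)) V) := fun V => by
    rw [hψtop, ker_sectionsMap_pullback_universalQuotient k _ Finsupp.basisSingleOne g V.2]
  have hK : IsAffineLocalizing (kernel ψ) :=
    isAffineLocalizing_of_isFiniteLocallyFree (HasRank.isFiniteLocallyFree'
      (hasRank_kernel_of_epi_freeModule ψ (hasRank_pullback_universalQuotient k _ Finsupp.basisSingleOne g)))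
  refine ⟨ψ, hψ, hepi, hK, hcl, ?_⟩
  rw [hiK]
  exact comap_vanishingIdeal_universalEquations_eq d k φGr hφGr g φT hφT ψ hcl hK

omit [IsClosedImmersion i] in
include hφGr hiK hφT hcl in
/-- **(V.) A CLOSED SUBSCHEME WHICH IS A BASE CHANGE OF THE UNIVERSAL FAMILY ALONG `g'` AND IS CLASSIFIED BY `g` FORCES `g' = g`**:
the cartesian square gives `𝓘(i) = 𝐏(g')⁻¹𝓘(Z_K)` (§1) `= V((kι_{ψ_{g'}} ≫ φ_T)♭)` (`exists_presentation_comap_ker_eq`), so `Z` lies in the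
vanishing locus of the equations of `g'`, and ★ (L-iv) `eq_of_classifies_of_le_ker_vanishingIdeal` concludes.
[cite: Mumford1966CurvesSurface, Lecture 15 (III.)–(V.) (pp. 106–108)] [cite: GortzWedhorn2020, (8.4) (pp. 213–215)] -/
theorem eq_of_isPullback_of_classifies {g' : T ⟶ grassmannianScheme ((Fin d → Fin (Nat.card ι + 1)) →₀ ℤ) k}
    {e : Z ⟶ ZK} (Hsq : IsPullback e i iK (Morphisms.projectiveSpaceMap ι g')) : g' = g := by
  obtain ⟨ψ, hψ, hepi, -, -, hEq⟩ := exists_presentation_comap_ker_eq d k φGr hφGr iK hiK g' φT hφT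
  exact eq_of_classifies_of_le_ker_vanishingIdeal d k g' g ψ hψ φT hφT i
    (by rw [ker_eq_comap_of_isPullback_of_isClosedImmersion Hsq, hEq]) hcl

include hφGr hiK hcut hφT hφT' hcl in
/-- **(IV.)–(V.) A FLAT FAMILY CLASSIFIED BY `g` IS THE BASE CHANGE OF THE UNIVERSAL FAMILY ALONG `g`**: for `Z ⊂ 𝐏(ι; T)` closed,
flat over the locally Noetherian `T` with the ranks `R e` (`e ≥ e₀`), and `g` its point of `Gr` through the monomial sections of `𝒪_Z(d)`:
`𝓘(i) = V((kι_{ψ_Z} ≫ φ_T)♭)` (`hcut`, `ψ_Z` the monomial map of `Z`, ★ `exists_hom_freeModule_app_eq`) `= V((kι_{ψ_g} ≫ φ_T)♭)` (★ (K′):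
both presentations have the sectionwise kernels `(pointsEquiv g)|_V`) `= 𝐏(g)⁻¹𝓘(Z_K)` (`exists_presentation_comap_ker_eq`), so
`Z = Z_K ×_{𝐏(ι; Gr)} 𝐏(ι; T)` (§1). [cite: Mumford1966CurvesSurface, Lecture 15 (IV.)–(V.) (pp. 107–108)] [cite: GortzWedhorn2020, Prop. 4.20 (p. 104)] -/
theorem exists_isPullback_of_classifies [IsLocallyNoetherian T] [Flat (i ≫ Morphisms.projectiveSpaceFst ι T)]
    (hrk : ∀ e, e₀ ≤ e → HasRank ((Scheme.Modules.pushforward (i ≫ Morphisms.projectiveSpaceFst ι T)).obj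
      (SerreTwist.twistMod (i ≫ pullback.snd (terminal.from T) (terminal.from (Morphisms.projectiveSpaceInt ι)))
        (unitModule Z) e)) (R e)) :
    ∃ e : Z ⟶ ZK, IsPullback e i iK (Morphisms.projectiveSpaceMap ι g) := by
  classical
  obtain ⟨ψ, -, -, hK, hclg, hEq⟩ := exists_presentation_comap_ker_eq d k φGr hφGr iK hiK g φT hφT
  -- the monomial map of `Z` and (II′)
  obtain ⟨ψZ, hψZ⟩ := exists_hom_freeModule_app_eq
    ((Scheme.Modules.pushforward (i ≫ Morphisms.projectiveSpaceFst ι T)).obj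
      (SerreTwist.twistMod (i ≫ pullback.snd (terminal.from T) (terminal.from (Morphisms.projectiveSpaceInt ι)))
        (unitModule Z) d))
    (fun w => show Γ((Scheme.Modules.pushforward (i ≫ Morphisms.projectiveSpaceFst ι T)).obj
      (SerreTwist.twistMod (i ≫ pullback.snd (terminal.from T) (terminal.from (Morphisms.projectiveSpaceInt ι)))
        (unitModule Z) d), ⊤) from
      SerreTwist.monomialSection (i ≫ pullback.snd (terminal.from T) (terminal.from (Morphisms.projectiveSpaceInt ι))) d w)
  have hcutZ := hcut i hrk ψZ hψZ φT hφT'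
  -- (K′): `ψ_Z` and `ψ_g` have the same sectionwise kernels
  have hψZtop : (fun w => ψZ.app ⊤ (freeSectionOn T w ⊤)) = fun w =>
      (show Γ((Scheme.Modules.pushforward (i ≫ Morphisms.projectiveSpaceFst ι T)).obj
        (SerreTwist.twistMod (i ≫ pullback.snd (terminal.from T) (terminal.from (Morphisms.projectiveSpaceInt ι)))
          (unitModule Z) d), ⊤) from
        SerreTwist.monomialSection (i ≫ pullback.snd (terminal.from T) (terminal.from (Morphisms.projectiveSpaceInt ι))) d w) := by
    funext w
    rw [hψZ w ⊤, show homOfLE (le_top : (⊤ : T.Opens) ≤ ⊤) = 𝟙 _ from Subsingleton.elim _ _, op_id,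
      ((Scheme.Modules.pushforward (i ≫ Morphisms.projectiveSpaceFst ι T)).obj
        (SerreTwist.twistMod (i ≫ pullback.snd (terminal.from T) (terminal.from (Morphisms.projectiveSpaceInt ι)))
          (unitModule Z) d)).presheaf.map_id]
    rfl
  have hKZ : IsAffineLocalizing (kernel ψZ) :=
    IsAffineLocalizing.kernel ψZ (isAffineLocalizing_freeModule T _) (isAffineLocalizing_pushforward_twistMod i d)
  have hK' := vanishingIdeal_transpose_kernel_ι_comp_eq_of_ker_sectionsMap_eq (Morphisms.projectiveSpaceFst ι T)
    (Finsupp.basisSingleOne : Module.Basis (Fin d → Fin (Nat.card ι + 1)) ℤ _) ψZ ψ φT hKZ hK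
    (isFiniteLocallyFree_twistMod_unitModule _ d) (fun V => by rw [hψZtop, ← hclg V]; exact (hcl V).symm)
  exact exists_isPullback_of_ker_eq_comap i iK (Morphisms.projectiveSpaceMap ι g) (by rw [hcutZ, hK', hEq])

/-! ## §3 The heads: (H1) the `Gr`-letter, (H2) the Hilbert-scheme universal property -/

include hφGr hiK hHB2 hcut hγ in
/-- **(H1) `Hilb^P ↪ Gr` IS REPRESENTED — the `Gr`-letter** ([Mumford1966CurvesSurface] Lect. 15 (III.)–(V.)).  There is an immersion
`j : H ↪ Gr = Grass_k(ℤ^{(Mon_d)})` such that for every `g : T ⟶ Gr` (`T` locally Noetherian): `g` factors (uniquely) through `j` IFF there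
is a closed `Z ⊂ 𝐏(ι; T)`, FLAT over `T` with `(p_Z)_*𝒪_Z(e)` locally free of rank `R e` for `e ≥ e₀`, whose point of `Gr` through the
monomial sections of `𝒪_Z(d)` is `g`.  (`H` = the flattening stratum of the universal family `Z_K` (`hHB2`); ⇒: `Z := Z_K ×_{𝐏(ι;Gr)} 𝐏(ι; T)`
is classified by SOME point (`hγ`), which is `g` by `eq_of_isPullback_of_classifies`; ⇐: `exists_isPullback_of_classifies`.)
[cite: Mumford1966CurvesSurface, Lecture 15 (III.)–(V.) (pp. 106–108)] [cite: GortzWedhorn2020, (8.4) (pp. 213–215)] -/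
theorem exists_isImmersion_iff_exists_flat_family_of :
    ∃ (H : Scheme.{0}) (j : H ⟶ grassmannianScheme ((Fin d → Fin (Nat.card ι + 1)) →₀ ℤ) k), IsImmersion j ∧
      ∀ ⦃T : Scheme.{0}⦄ [IsLocallyNoetherian T] (g : T ⟶ grassmannianScheme ((Fin d → Fin (Nat.card ι + 1)) →₀ ℤ) k),
        (∃! v : T ⟶ H, v ≫ j = g) ↔
          ∃ (Z : Scheme.{0}) (i : Z ⟶ Morphisms.projectiveSpace ι T) (_ : IsClosedImmersion i),
            Flat (i ≫ Morphisms.projectiveSpaceFst ι T) ∧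
            (∀ e, e₀ ≤ e → HasRank ((Scheme.Modules.pushforward (i ≫ Morphisms.projectiveSpaceFst ι T)).obj
              (SerreTwist.twistMod (i ≫ pullback.snd (terminal.from T) (terminal.from (Morphisms.projectiveSpaceInt ι)))
                (unitModule Z) e)) (R e)) ∧
            ∀ V : T.affineOpens,
              (evalAffine V.2 (pointsEquiv ((Fin d → Fin (Nat.card ι + 1)) →₀ ℤ) k T g)).toSubmodule =
                LinearMap.ker (sectionsMap (Finsupp.basisSingleOne : Module.Basis (Fin d → Fin (Nat.card ι + 1)) ℤ _)
                  ((Scheme.Modules.pushforward (i ≫ Morphisms.projectiveSpaceFst ι T)).obj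
                    (SerreTwist.twistMod (i ≫ pullback.snd (terminal.from T) (terminal.from (Morphisms.projectiveSpaceInt ι)))
                      (unitModule Z) d))
                  (fun w => SerreTwist.monomialSection
                    (i ≫ pullback.snd (terminal.from T) (terminal.from (Morphisms.projectiveSpaceInt ι))) d w) V) := by
  classical
  obtain ⟨H, j, hj, hrep⟩ := hHB2
  refine ⟨H, j, hj, fun T _ g => ?_⟩
  obtain ⟨φT, hφT, hφT'⟩ := exists_monomialMap_projectiveSpace (ι := ι) T d
  constructor
  · intro hv
    have Hsq : IsPullback (pullback.fst iK (Morphisms.projectiveSpaceMap ι g)) (pullback.snd iK (Morphisms.projectiveSpaceMap ι g))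
        iK (Morphisms.projectiveSpaceMap ι g) := IsPullback.of_hasPullback _ _
    obtain ⟨hflat, hrk⟩ := (hrep g (pullback.snd iK (Morphisms.projectiveSpaceMap ι g))
      (pullback.fst iK (Morphisms.projectiveSpaceMap ι g)) Hsq).mp hv
    haveI := hflat
    obtain ⟨g', hg'⟩ := hγ (pullback.snd iK (Morphisms.projectiveSpaceMap ι g)) hrk
    obtain rfl : g = g' :=
      eq_of_isPullback_of_classifies d k φGr hφGr iK hiK g' φT hφT (pullback.snd iK (Morphisms.projectiveSpaceMap ι g)) hg' Hsq
    exact ⟨_, pullback.snd iK (Morphisms.projectiveSpaceMap ι g), inferInstance, hflat, hrk, hg'⟩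
  · rintro ⟨Z, i, hi, hflat, hrk, hcl⟩
    obtain ⟨e, He⟩ := exists_isPullback_of_classifies d k φGr hφGr iK hiK e₀ R hcut g φT hφT hφT' i hcl hrk
    exact (hrep g i e He).mpr ⟨hflat, hrk⟩

include hφGr hiK hHB2 hcut hγ in
/-- **(H2) THE HILBERT SCHEME OF `𝐏(ι)`: THE UNIVERSAL FLAT FAMILY** ([Mumford1966CurvesSurface] Lect. 15; [MumfordFogartyKirwan1994] Ch. 0
§5 (c)).  There are an immersion `j : H ↪ Gr` with `H` locally Noetherian and a closed `Z_H ⊂ 𝐏(ι; H)`, FLAT over `H` with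
`(p_{Z_H})_*𝒪_{Z_H}(e)` locally free of rank `R e` for `e ≥ e₀`, such that EVERY closed `Z ⊂ 𝐏(ι; T)` flat over a locally Noetherian `T`
with these ranks is the pull-back of `Z_H` along a UNIQUE `v : T ⟶ H`: `∃! v, ∃ e, Z —e→ Z_H` cartesian over `𝐏(v) : 𝐏(ι; T) → 𝐏(ι; H)`.
(`Z_H := Z_K ×_{𝐏(ι;Gr)} 𝐏(ι; H)`, flat with the ranks by `hHB2` at `𝟙_H`; existence: the point `g` of `Z` (`hγ`), the square over `g`
(`exists_isPullback_of_classifies`), `g = v ≫ j` (`hHB2`), pasting; uniqueness: a square over `v'` pastes to one over `v' ≫ j`, so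
`v' ≫ j = g` (`eq_of_isPullback_of_classifies`) and `v' = v`.)
[cite: Mumford1966CurvesSurface, Lecture 15 (III.)–(V.) (pp. 106–108)] [cite: MumfordFogartyKirwan1994, Ch. 0 §5 (c) (p. 23)] -/
theorem exists_universal_flat_family_of :
    ∃ (H : Scheme.{0}) (j : H ⟶ grassmannianScheme ((Fin d → Fin (Nat.card ι + 1)) →₀ ℤ) k) (_ : IsImmersion j)
      (_ : IsLocallyNoetherian H) (ZH : Scheme.{0}) (iH : ZH ⟶ Morphisms.projectiveSpace ι H) (_ : IsClosedImmersion iH),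
      (Flat (iH ≫ Morphisms.projectiveSpaceFst ι H) ∧
        ∀ e, e₀ ≤ e → HasRank ((Scheme.Modules.pushforward (iH ≫ Morphisms.projectiveSpaceFst ι H)).obj
          (SerreTwist.twistMod (iH ≫ pullback.snd (terminal.from H) (terminal.from (Morphisms.projectiveSpaceInt ι)))
            (unitModule ZH) e)) (R e)) ∧
      ∀ ⦃T : Scheme.{0}⦄ [IsLocallyNoetherian T] ⦃Z : Scheme.{0}⦄ (i : Z ⟶ Morphisms.projectiveSpace ι T)
        [IsClosedImmersion i] [Flat (i ≫ Morphisms.projectiveSpaceFst ι T)],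
        (∀ e, e₀ ≤ e → HasRank ((Scheme.Modules.pushforward (i ≫ Morphisms.projectiveSpaceFst ι T)).obj
          (SerreTwist.twistMod (i ≫ pullback.snd (terminal.from T) (terminal.from (Morphisms.projectiveSpaceInt ι)))
            (unitModule Z) e)) (R e)) →
        ∃! v : T ⟶ H, ∃ e : Z ⟶ ZH, IsPullback e i iH (Morphisms.projectiveSpaceMap ι v) := by
  classical
  obtain ⟨H, j, hj, hrep⟩ := hHB2
  haveI := hj
  haveI : IsLocallyNoetherian (grassmannianScheme ((Fin d → Fin (Nat.card ι + 1)) →₀ ℤ) k) :=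
    Grassmannian.isLocallyNoetherian _ k
  haveI : IsLocallyNoetherian H := LocallyOfFiniteType.isLocallyNoetherian j
  -- the universal family over `H`: flat with the ranks, by `hHB2` at `𝟙_H`
  have HsqH : IsPullback (pullback.fst iK (Morphisms.projectiveSpaceMap ι j)) (pullback.snd iK (Morphisms.projectiveSpaceMap ι j))
      iK (Morphisms.projectiveSpaceMap ι j) := IsPullback.of_hasPullback _ _
  obtain ⟨hflatH, hrkH⟩ := (hrep j (pullback.snd iK (Morphisms.projectiveSpaceMap ι j))
    (pullback.fst iK (Morphisms.projectiveSpaceMap ι j)) HsqH).mp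
    ⟨𝟙 H, Category.id_comp j, fun v hv => by rw [← cancel_mono j, hv, Category.id_comp]⟩
  refine ⟨H, j, hj, inferInstance, pullback iK (Morphisms.projectiveSpaceMap ι j),
    pullback.snd iK (Morphisms.projectiveSpaceMap ι j), inferInstance, ⟨hflatH, hrkH⟩, fun T _ Z i _ _ hrk => ?_⟩
  obtain ⟨φT, hφT, hφT'⟩ := exists_monomialMap_projectiveSpace (ι := ι) T d
  -- the point of `Z`, the square over it, the factorisation through `j`
  obtain ⟨g, hcl⟩ := hγ i hrk
  obtain ⟨e, He⟩ := exists_isPullback_of_classifies d k φGr hφGr iK hiK e₀ R hcut g φT hφT hφT' i hcl hrk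
  obtain ⟨v, hv, hvu⟩ := (hrep g i e He).mpr ⟨inferInstance, hrk⟩
  have hsq2 : Morphisms.projectiveSpaceMap ι g = Morphisms.projectiveSpaceMap ι v ≫ Morphisms.projectiveSpaceMap ι j := by
    rw [← hv, projectiveSpaceMap_comp']
  refine ⟨v, ⟨pullback.lift e (i ≫ Morphisms.projectiveSpaceMap ι v) (by rw [Category.assoc, ← hsq2]; exact He.w),
    IsPullback.of_right (by rw [pullback.lift_fst, ← hsq2]; exact He) (pullback.lift_snd _ _ _) HsqH⟩, ?_⟩
  -- uniqueness: a square over `v'` makes `Z` the base change along `v' ≫ j`; `Z` being classified by `g`, `v' ≫ j = g`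
  rintro v' ⟨e', He'⟩
  have Hbig : IsPullback (e' ≫ pullback.fst iK (Morphisms.projectiveSpaceMap ι j)) i iK
      (Morphisms.projectiveSpaceMap ι (v' ≫ j)) := by
    rw [projectiveSpaceMap_comp']
    exact He'.paste_horiz HsqH
  exact hvu v' (eq_of_isPullback_of_classifies d k φGr hφGr iK hiK g φT hφT i hcl Hbig)

/-! ## §4 The heads at the vanishing locus `Z_𝒦 := V((kι_𝒦 ≫ φ_Gr)♭)` of the universal equations itself -/

variable
  -- (H-B2) at `Z_𝒦 := (V((kι_𝒦 ≫ φ_Gr)♭)).subscheme` — the letter ★ slot ⑩b `exists_immersion_factors_iff_flat_and_hasRank'` produces there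
  (hHB2K : ∃ (H : Scheme.{0}) (j : H ⟶ grassmannianScheme ((Fin d → Fin (Nat.card ι + 1)) →₀ ℤ) k), IsImmersion j ∧
    ∀ ⦃T : Scheme.{0}⦄ [IsLocallyNoetherian T] (g : T ⟶ grassmannianScheme ((Fin d → Fin (Nat.card ι + 1)) →₀ ℤ) k)
      ⦃ZT : Scheme.{0}⦄ (iT : ZT ⟶ Morphisms.projectiveSpace ι T) [IsClosedImmersion iT]
      (kT : ZT ⟶ (vanishingIdeal (((Scheme.Modules.pullbackPushforwardAdjunction
        (Morphisms.projectiveSpaceFst ι (grassmannianScheme ((Fin d → Fin (Nat.card ι + 1)) →₀ ℤ) k))).homEquiv _ _).symm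
        (kernel.ι (universalQuotientπ k ((Fin d → Fin (Nat.card ι + 1)) →₀ ℤ) Finsupp.basisSingleOne) ≫ φGr))).subscheme)
      (_ : IsPullback kT iT (vanishingIdeal (((Scheme.Modules.pullbackPushforwardAdjunction
        (Morphisms.projectiveSpaceFst ι (grassmannianScheme ((Fin d → Fin (Nat.card ι + 1)) →₀ ℤ) k))).homEquiv _ _).symm
        (kernel.ι (universalQuotientπ k ((Fin d → Fin (Nat.card ι + 1)) →₀ ℤ) Finsupp.basisSingleOne) ≫ φGr))).subschemeι
        (Morphisms.projectiveSpaceMap ι g)),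
      (∃! v : T ⟶ H, v ≫ j = g) ↔
        (Flat (iT ≫ Morphisms.projectiveSpaceFst ι T) ∧ ∀ e, e₀ ≤ e → HasRank
          ((Scheme.Modules.pushforward (iT ≫ Morphisms.projectiveSpaceFst ι T)).obj
            (SerreTwist.twistMod (iT ≫ pullback.snd (terminal.from T) (terminal.from (Morphisms.projectiveSpaceInt ι)))
              (unitModule ZT) e)) (R e)))

include hφGr hHB2K hcut hγ in
/-- **(H2) AT THE UNIVERSAL LOCUS `Z_𝒦 = V((kι_𝒦 ≫ φ_Gr)♭)`** (Mathlib `IdealSheafData.subscheme`, `ker_subschemeι`): the Hilbert-scheme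
universal property of §3 with the universal family taken to be the vanishing locus of the universal equations ITSELF — the form in which
★ slot ⑩b `exists_immersion_factors_iff_flat_and_hasRank'` (at `S := Gr`, `iK := subschemeι`) discharges `hHB2K` by name.
[cite: Mumford1966CurvesSurface, Lecture 15 (III.)–(V.) (pp. 106–108)] [cite: MumfordFogartyKirwan1994, Ch. 0 §5 (c) (p. 23)] -/
theorem exists_universal_flat_family_of_vanishingLocus :
    ∃ (H : Scheme.{0}) (j : H ⟶ grassmannianScheme ((Fin d → Fin (Nat.card ι + 1)) →₀ ℤ) k) (_ : IsImmersion j)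
      (_ : IsLocallyNoetherian H) (ZH : Scheme.{0}) (iH : ZH ⟶ Morphisms.projectiveSpace ι H) (_ : IsClosedImmersion iH),
      (Flat (iH ≫ Morphisms.projectiveSpaceFst ι H) ∧
        ∀ e, e₀ ≤ e → HasRank ((Scheme.Modules.pushforward (iH ≫ Morphisms.projectiveSpaceFst ι H)).obj
          (SerreTwist.twistMod (iH ≫ pullback.snd (terminal.from H) (terminal.from (Morphisms.projectiveSpaceInt ι)))
            (unitModule ZH) e)) (R e)) ∧
      ∀ ⦃T : Scheme.{0}⦄ [IsLocallyNoetherian T] ⦃Z : Scheme.{0}⦄ (i : Z ⟶ Morphisms.projectiveSpace ι T)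
        [IsClosedImmersion i] [Flat (i ≫ Morphisms.projectiveSpaceFst ι T)],
        (∀ e, e₀ ≤ e → HasRank ((Scheme.Modules.pushforward (i ≫ Morphisms.projectiveSpaceFst ι T)).obj
          (SerreTwist.twistMod (i ≫ pullback.snd (terminal.from T) (terminal.from (Morphisms.projectiveSpaceInt ι)))
            (unitModule Z) e)) (R e)) →
        ∃! v : T ⟶ H, ∃ e : Z ⟶ ZH, IsPullback e i iH (Morphisms.projectiveSpaceMap ι v) :=
  exists_universal_flat_family_of d k φGr hφGr _ (Scheme.IdealSheafData.ker_subschemeι _) e₀ R hHB2K hcut hγ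

include hφGr hHB2K hcut hγ in
/-- **(H1) AT THE UNIVERSAL LOCUS `Z_𝒦 = V((kι_𝒦 ≫ φ_Gr)♭)`**: the `Gr`-letter head of §3 with the universal family taken to be the vanishing
locus of the universal equations itself. [cite: Mumford1966CurvesSurface, Lecture 15 (III.)–(V.) (pp. 106–108)] [cite: GortzWedhorn2020, (8.4) (pp. 213–215)] -/
theorem exists_isImmersion_iff_exists_flat_family_of_vanishingLocus :
    ∃ (H : Scheme.{0}) (j : H ⟶ grassmannianScheme ((Fin d → Fin (Nat.card ι + 1)) →₀ ℤ) k), IsImmersion j ∧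
      ∀ ⦃T : Scheme.{0}⦄ [IsLocallyNoetherian T] (g : T ⟶ grassmannianScheme ((Fin d → Fin (Nat.card ι + 1)) →₀ ℤ) k),
        (∃! v : T ⟶ H, v ≫ j = g) ↔
          ∃ (Z : Scheme.{0}) (i : Z ⟶ Morphisms.projectiveSpace ι T) (_ : IsClosedImmersion i),
            Flat (i ≫ Morphisms.projectiveSpaceFst ι T) ∧
            (∀ e, e₀ ≤ e → HasRank ((Scheme.Modules.pushforward (i ≫ Morphisms.projectiveSpaceFst ι T)).obj
              (SerreTwist.twistMod (i ≫ pullback.snd (terminal.from T) (terminal.from (Morphisms.projectiveSpaceInt ι)))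
                (unitModule Z) e)) (R e)) ∧
            ∀ V : T.affineOpens,
              (evalAffine V.2 (pointsEquiv ((Fin d → Fin (Nat.card ι + 1)) →₀ ℤ) k T g)).toSubmodule =
                LinearMap.ker (sectionsMap (Finsupp.basisSingleOne : Module.Basis (Fin d → Fin (Nat.card ι + 1)) ℤ _)
                  ((Scheme.Modules.pushforward (i ≫ Morphisms.projectiveSpaceFst ι T)).obj
                    (SerreTwist.twistMod (i ≫ pullback.snd (terminal.from T) (terminal.from (Morphisms.projectiveSpaceInt ι)))
                      (unitModule Z) d))
                  (fun w => SerreTwist.monomialSection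
                    (i ≫ pullback.snd (terminal.from T) (terminal.from (Morphisms.projectiveSpaceInt ι))) d w) V) :=
  exists_isImmersion_iff_exists_flat_family_of d k φGr hφGr _ (Scheme.IdealSheafData.ker_subschemeι _) e₀ R hHB2K hcut hγ

/-! ## §5 (ed. 2) `hcut`∕`hγ` DISCHARGED (★ (II′), ★ ③b): (H2) modulo the flattening stratum of the universal family (`hHB2K`) only -/

open Polynomial Literature.Algebra.Homology.LaurentCech

variable (hn : 1 ≤ Nat.card ι) (P : ℚ[X]) (hR : ∀ e, e₀ ≤ e → (R e : ℚ) = P.eval (e : ℚ)) (hk : (k : ℚ) = P.eval (d : ℚ))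
  (hd : regularityBound (preHilbertPoly ℚ (Nat.card ι) 0) 0 (preHilbertPoly ℚ (Nat.card ι) 0 - P) ≤ (d : ℤ))

include hφGr hHB2K hn hR hk hd in
/-- **(H2) THE HILBERT SCHEME `Hilb^P_{𝐏(ι)}` MODULO THE FLATTENING STRATUM OF THE UNIVERSAL FAMILY** ([Mumford1966CurvesSurface] Lect. 15;
[MumfordFogartyKirwan1994] Ch. 0 §5 (c)): for `d ≥ B(P)` and `k = P(d)`, an immersion `j : H ↪ Gr` (`H` locally Noetherian) and a closed
`Z_H ⊂ 𝐏(ι; H)` flat over `H` with `(p_{Z_H})_*𝒪(e)` of rank `R e = P(e)` (`e ≥ e₀`), universal among closed flat families with these ranks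
over locally Noetherian bases — §4 with `hcut := ker_eq_vanishingIdeal_transpose_of_flat_of_hasRank_twists` (★ (II′)) and
`hγ := existsUnique_hom_grassmannian_of_hasRank_twists … |>.exists` (★ ③b); the one remaining hypothesis `hHB2K` is ★ ⑩b's letter at `Z_𝒦`.
[cite: Mumford1966CurvesSurface, Lecture 15 (III.)–(V.) (pp. 106–108)] [cite: MumfordFogartyKirwan1994, Ch. 0 §5 (c) (p. 23)] -/
theorem exists_universal_flat_family_of_flatteningStratum :
    ∃ (H : Scheme.{0}) (j : H ⟶ grassmannianScheme ((Fin d → Fin (Nat.card ι + 1)) →₀ ℤ) k) (_ : IsImmersion j)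
      (_ : IsLocallyNoetherian H) (ZH : Scheme.{0}) (iH : ZH ⟶ Morphisms.projectiveSpace ι H) (_ : IsClosedImmersion iH),
      (Flat (iH ≫ Morphisms.projectiveSpaceFst ι H) ∧
        ∀ e, e₀ ≤ e → HasRank ((Scheme.Modules.pushforward (iH ≫ Morphisms.projectiveSpaceFst ι H)).obj
          (SerreTwist.twistMod (iH ≫ pullback.snd (terminal.from H) (terminal.from (Morphisms.projectiveSpaceInt ι)))
            (unitModule ZH) e)) (R e)) ∧
      ∀ ⦃T : Scheme.{0}⦄ [IsLocallyNoetherian T] ⦃Z : Scheme.{0}⦄ (i : Z ⟶ Morphisms.projectiveSpace ι T)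
        [IsClosedImmersion i] [Flat (i ≫ Morphisms.projectiveSpaceFst ι T)],
        (∀ e, e₀ ≤ e → HasRank ((Scheme.Modules.pushforward (i ≫ Morphisms.projectiveSpaceFst ι T)).obj
          (SerreTwist.twistMod (i ≫ pullback.snd (terminal.from T) (terminal.from (Morphisms.projectiveSpaceInt ι)))
            (unitModule Z) e)) (R e)) →
        ∃! v : T ⟶ H, ∃ e : Z ⟶ ZH, IsPullback e i iH (Morphisms.projectiveSpaceMap ι v) := by
  have hd' : regularityBound (preHilbertPoly ℚ (Nat.card ι) 0) 0 (preHilbertPoly ℚ (Nat.card ι) 0 - P) - 1 ≤ (d : ℤ) := by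
    linarith
  exact exists_universal_flat_family_of_vanishingLocus d k φGr hφGr e₀ R
    (fun T Z _ i _ _ hrk ψ hψ φ hφ =>
      ker_eq_vanishingIdeal_transpose_of_flat_of_hasRank_twists i d ψ hψ φ hφ hn P e₀ R hR hrk k hk hd)
    (fun T Z _ i _ _ hrk => (existsUnique_hom_grassmannian_of_hasRank_twists hn i P e₀ R hR hrk d k hk hd').exists) hHB2K

end Hilb

/-! ## §6 (ed. 3) THE HILBERT SCHEME OF `𝐏(ι)`, CLOSED: ★ ⑩b at `Gr_ℤ` fed by the uniform field-point letters ★ (ε) ed. 2 -/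

section Closed

open Polynomial Literature.Algebra.Homology.LaurentCech CategoryTheory.Abelian

/-- **`Hilb^P_{𝐏(ι)} ↪ Grass_{P(d)}(ℤ^{(Mon_d)})` WITH ITS UNIVERSAL FAMILY — CLOSED FORM, IMMERSION KEPT**: `d := B(P)⁺ + e₁`, `k := R d`,
`e₀ := max m₀ (max e₁ 1)` (★ `isRepresentable_grassmannianSheaf`, ★ `Grassmannian.isNoetherian`, `φ_Gr` by §2, ★ (ε) `exists_uniform_letters_forall_fieldPoint`
at `Z_𝒦`, ★ ⑩b, §5). [cite: Mumford1966CurvesSurface, Lecture 15 (III.)–(V.) (pp. 106–108)] [cite: MumfordFogartyKirwan1994, Ch. 0 §5 (c) (p. 23)] -/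
theorem exists_grassmannianImmersion_universal_flat_family {ι : Type} (hn : 1 ≤ Nat.card ι) (P : ℚ[X]) (e₁ : ℕ) (R : ℕ → ℕ)
    (hR : ∀ e, e₁ ≤ e → (R e : ℚ) = P.eval (e : ℚ)) :
    ∃ (d k e₀ : ℕ) (_ : 0 < e₀) (_ : e₁ ≤ e₀) (_ : (grassmannianSheaf ((Fin d → Fin (Nat.card ι + 1)) →₀ ℤ) k).obj.IsRepresentable)
      (H : Scheme.{0}) (j : H ⟶ grassmannianScheme ((Fin d → Fin (Nat.card ι + 1)) →₀ ℤ) k) (_ : IsImmersion j)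
      (_ : IsLocallyNoetherian H) (ZH : Scheme.{0}) (iH : ZH ⟶ Morphisms.projectiveSpace ι H) (_ : IsClosedImmersion iH),
      (Flat (iH ≫ Morphisms.projectiveSpaceFst ι H) ∧
        ∀ e, e₀ ≤ e → HasRank ((Scheme.Modules.pushforward (iH ≫ Morphisms.projectiveSpaceFst ι H)).obj
          (SerreTwist.twistMod (iH ≫ pullback.snd (terminal.from H) (terminal.from (Morphisms.projectiveSpaceInt ι)))
            (unitModule ZH) e)) (R e)) ∧
      ∀ ⦃T : Scheme.{0}⦄ [IsLocallyNoetherian T] ⦃Z : Scheme.{0}⦄ (i : Z ⟶ Morphisms.projectiveSpace ι T)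
        [IsClosedImmersion i] [Flat (i ≫ Morphisms.projectiveSpaceFst ι T)],
        (∀ e, e₀ ≤ e → HasRank ((Scheme.Modules.pushforward (i ≫ Morphisms.projectiveSpaceFst ι T)).obj
          (SerreTwist.twistMod (i ≫ pullback.snd (terminal.from T) (terminal.from (Morphisms.projectiveSpaceInt ι)))
            (unitModule Z) e)) (R e)) →
        ∃! v : T ⟶ H, ∃ e : Z ⟶ ZH, IsPullback e i iH (Morphisms.projectiveSpaceMap ι v) := by
  classical
  have hd : regularityBound (preHilbertPoly ℚ (Nat.card ι) 0) 0 (preHilbertPoly ℚ (Nat.card ι) 0 - P) ≤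
      (((regularityBound (preHilbertPoly ℚ (Nat.card ι) 0) 0 (preHilbertPoly ℚ (Nat.card ι) 0 - P)).toNat + e₁ : ℕ) : ℤ) := by
    have := Int.self_le_toNat (regularityBound (preHilbertPoly ℚ (Nat.card ι) 0) 0 (preHilbertPoly ℚ (Nat.card ι) 0 - P)); push_cast; omega
  set d : ℕ := (regularityBound (preHilbertPoly ℚ (Nat.card ι) 0) 0 (preHilbertPoly ℚ (Nat.card ι) 0 - P)).toNat + e₁ with hd_def
  haveI := Grassmannian.isRepresentable_grassmannianSheaf ((Fin d → Fin (Nat.card ι + 1)) →₀ ℤ) (R d)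
  haveI := Grassmannian.isNoetherian ((Fin d → Fin (Nat.card ι + 1)) →₀ ℤ) (R d); have hk := hR d (Nat.le_add_left _ _)
  obtain ⟨φGr, hφGr, -⟩ := exists_monomialMap_projectiveSpace (ι := ι) (grassmannianScheme ((Fin d → Fin (Nat.card ι + 1)) →₀ ℤ) (R d)) d
  obtain ⟨m₀, N, hpack⟩ := Literature.AlgebraicGeometry.Modules.exists_uniform_letters_forall_fieldPoint
    ((vanishingIdeal (((Scheme.Modules.pullbackPushforwardAdjunction
      (Morphisms.projectiveSpaceFst ι (grassmannianScheme ((Fin d → Fin (Nat.card ι + 1)) →₀ ℤ) (R d)))).homEquiv _ _).symm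
      (kernel.ι (universalQuotientπ (R d) ((Fin d → Fin (Nat.card ι + 1)) →₀ ℤ) Finsupp.basisSingleOne) ≫ φGr))).subschemeι)
    hn (fun e => (coh_pushforward_twistMod_unitModule _ e).loc) (fun e => (coh_pushforward_twistMod_unitModule _ e).ft)
  obtain ⟨ρ, hρ, hpoly, hS, hvan⟩ := hpack (max m₀ (max e₁ 1)) (le_max_left _ _)
  have hR' : ∀ e, max m₀ (max e₁ 1) ≤ e → (R e : ℚ) = P.eval (e : ℚ) := fun e he => hR e (by omega)
  have hpoly' : ∀ s, ∃ p : Polynomial ℚ, p.natDegree ≤ max N P.natDegree ∧ ∀ m, (ρ s m : ℚ) = p.eval (m : ℚ) :=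
    fun s => by obtain ⟨p, hp, hpm⟩ := hpoly s; exact ⟨p, hp.trans (le_max_left _ _), hpm⟩
  obtain ⟨H, j, hj, hH, ZH, iH, hiH, hflat, huniv⟩ := exists_universal_flat_family_of_flatteningStratum d (R d) φGr hφGr _ R
    (Literature.AlgebraicGeometry.Modules.exists_immersion_factors_iff_flat_and_hasRank' _ P _ _ (le_max_right N P.natDegree) R hR'
      ρ hρ hpoly' hS hvan) hn P hR' hk hd
  exact ⟨d, R d, max m₀ (max e₁ 1), by omega, by omega, inferInstance, H, j, hj, hH, ZH, iH, hiH, hflat, huniv⟩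

/-- **THE HILBERT SCHEME `Hilb^P_{𝐏(ι)}` — CLOSED FORM** ([Mumford1966CurvesSurface] Lect. 15; [MumfordFogartyKirwan1994] Ch. 0 §5 (c)).
For `#ι ≥ 1`, a polynomial `P ∈ ℚ[X]` and integer values `R e = P(e)` (`e ≥ e₁`): there are `e₀ ≥ e₁`, a locally Noetherian scheme `H`
and a closed `Z_H ⊂ 𝐏(ι; H)`, FLAT over `H` with `(p_{Z_H})_*𝒪_{Z_H}(e)` locally free of rank `R e` (`e ≥ e₀`), such that every closed
`Z ⊂ 𝐏(ι; T)` flat over a locally Noetherian `T` with these ranks is the pull-back of `Z_H` along a UNIQUE `v : T ⟶ H`.  Assembly: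
`d := B(P)⁺ + e₁`, `k := R d`, `Gr := Grass_k(ℤ^{(Mon_d)})` (★ `isRepresentable_grassmannianSheaf`, ★ `Grassmannian.isNoetherian`), the
universal equations `φ_Gr` (§2), the uniform letters of ★ (ε) `exists_uniform_letters_forall_fieldPoint` for `Z_𝒦 ⊂ 𝐏(ι; Gr)` at
`e₀ := max m₀ e₁`, the flattening stratum ★ ⑩b `exists_immersion_factors_iff_flat_and_hasRank'`, and §5.
[cite: Mumford1966CurvesSurface, Lecture 15 (III.)–(V.) (pp. 106–108)] [cite: MumfordFogartyKirwan1994, Ch. 0 §5 (c) (p. 23)] -/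
theorem exists_universal_flat_family {ι : Type} (hn : 1 ≤ Nat.card ι) (P : ℚ[X]) (e₁ : ℕ) (R : ℕ → ℕ)
    (hR : ∀ e, e₁ ≤ e → (R e : ℚ) = P.eval (e : ℚ)) :
    ∃ (e₀ : ℕ) (_ : e₁ ≤ e₀) (H : Scheme.{0}) (_ : IsLocallyNoetherian H) (ZH : Scheme.{0})
      (iH : ZH ⟶ Morphisms.projectiveSpace ι H) (_ : IsClosedImmersion iH),
      (Flat (iH ≫ Morphisms.projectiveSpaceFst ι H) ∧
        ∀ e, e₀ ≤ e → HasRank ((Scheme.Modules.pushforward (iH ≫ Morphisms.projectiveSpaceFst ι H)).obj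
          (SerreTwist.twistMod (iH ≫ pullback.snd (terminal.from H) (terminal.from (Morphisms.projectiveSpaceInt ι)))
            (unitModule ZH) e)) (R e)) ∧
      ∀ ⦃T : Scheme.{0}⦄ [IsLocallyNoetherian T] ⦃Z : Scheme.{0}⦄ (i : Z ⟶ Morphisms.projectiveSpace ι T)
        [IsClosedImmersion i] [Flat (i ≫ Morphisms.projectiveSpaceFst ι T)],
        (∀ e, e₀ ≤ e → HasRank ((Scheme.Modules.pushforward (i ≫ Morphisms.projectiveSpaceFst ι T)).obj
          (SerreTwist.twistMod (i ≫ pullback.snd (terminal.from T) (terminal.from (Morphisms.projectiveSpaceInt ι)))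
            (unitModule Z) e)) (R e)) →
        ∃! v : T ⟶ H, ∃ e : Z ⟶ ZH, IsPullback e i iH (Morphisms.projectiveSpaceMap ι v) := by
  obtain ⟨d, k, e₀, -, he₁, _, H, j, -, hH, ZH, iH, hiH, h⟩ := exists_grassmannianImmersion_universal_flat_family hn P e₁ R hR
  exact ⟨e₀, he₁, H, hH, ZH, iH, hiH, h⟩

end Closed

end Literature.AlgebraicGeometry.Motives

end
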